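import Summits.ValiantsHypothesis.ValiantsHypothesis.Theorems.EquivariantDialThresholdPermify
import HarnessLib

/-!
# ValiantsHypothesis — the equivariant dial: THRESHOLD PERMIFY, file 5/5 — `EqHard` below the
# polylog sliver: ALL polylog heads `Δ(𝔖_{(log₂ m)^E} ⊕ 1)`, `E ≥ 2`

Helper of `stmt-ValiantsHypothesis-23702` (`--as helper`; 0 definitions, 0 named facts, closes NO
item).  Decomposition workshop VALIANT, lens-1, g36, offer O-L1-28 «THRESHOLD PERMIFY».

State before this file (g35, `eqHard_diagHead_polylog`): `EqHard` for the heads `(log₂ m)^E` with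
`E > D`, `D` the UNCOMPUTED loss exponent of `diag_permify`; the polylog range `2 ≤ E ≤ D` undecided.

THIS FILE.
* ★★ `eqHard_of_nearExpHeredity` — `EqHard` from NEAR-EXPONENTIAL RATE HEREDITY (file 4,
  `nearExp_of_heredity`): a notch family `K` with diagonal reach `b` and
  `(log₂ (n + b n) + 1)(log₂ n + 1) = o(n)` (stated `∀ a, eventually a (log₂ (n + b n) + 1)(log₂ n + 1) < n`)
  carries no polynomial equivariant family.
* ★★ `eqHard_diagHead_polylog_two` — ALL POLYLOG HEADS ARE HARD: for every `E ≥ 2` the permanents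
  have no polynomial family of `Δ(𝔖_{(log₂ m)^E} ⊕ 1)`-equivariant (exact `GL × GL` lifts) affine
  determinantal representations.  Reach `m(n) = 2^{2(⌊√n⌋ + 1)}`: `n < (⌊√n⌋ + 1)^2 ≤ m(n)`,
  `log₂ m(n) = 2(⌊√n⌋ + 1)` and `(log₂ m)^E ≥ (log₂ m)^2 > n`, while
  `a (2⌊√n⌋ + 3)(log₂ n + 1) < n` eventually (`sqrt_log_eventually_lt`, from `polylog_eventually_lt`).

HONEST BOUNDARY: 0 S-currency; closes NO item; `EqHard` conclusions are S-implied (S ⇒ W ⇒ EqHard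
H); the rate conclusion is a restricted-model lower bound of Dawar–Wilsenach class (equivariant =
symmetric model), not a statement about dc(per_m); permify is made POLYNOMIAL in the matrix size for
each fixed threshold τ (index budget (n+1)^{2τ}), but an irreducible block of dimension k still
forces τ > 2 log₂ k, so the total loss is n^{O(log s)} and the diagonal rate is 2^{Ω(n/log n)} i.o.,
NOT 2^{Ω(n)} (Grenet's upper bound 2^n − 1 is matched only up to the log); the residual sliver log₂
m/log₂ log₂ m ≲ t(m) ≲ log₂ m·log₂ log₂ m of diagonal heads (it contains t = log₂ m) stays
UNDECIDED · IDEA-NEEDED (needs poly(f^λ)-index fixed-vector subgroups for all λ, or an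
index-law-beating engine); F1/F2 and the budget forms of (H2)/(diag_permify) are budget-generic
TRANSCRIPTIONS of tree proofs, the new mathematics is the threshold dichotomy (from the PROVED
Literature fact spechtDimDichotomy) and the rate bookkeeping; P-ROW and the cyclic notches Δ⟨π⟩ of
superpolynomial order are NOT touched; stmt-23702 / VP ≠ VNP untouched.

LABEL (critic RULING + CALL GO, bus 3237, verbatim): «O-L1-28 (lens-1 g36): ELEMENTARY ·
NEW-COMBINATION leaning NEW-INPUT (the PROVED Literature theorem spechtDimDichotomy — James–Kerber
2.4.3/2.4.10 branching, a crude effective Rasala — pointed at equivariant determinantal symmetry for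
the first time, as a THRESHOLD Young dichotomy «a row/column side of λ has Young subgroup of index ≤
(n+1)^τ OR f^λ ≥ 2^{⌊τ/2⌋}» replacing the quasi-polynomial YoungDegreeBound budget × the g33–g35
permify / rate-heredity chain made budget-generic) · BEATS the 3118 polylog sliver: permify at
POLYNOMIAL loss (n+1)^{2τ} per fixed threshold τ, total n^{O(log s)}; diagonal RATE edc_Δ(per_n) ≥
2^{Ω(n/log n)} i.o. (restricted model, Dawar–Wilsenach class; Grenet's equivariant 2^n − 1 matched
up to the log in the exponent); heredity LAW threshold t ≫ log₂ m·log₂ log₂ m; EVERY polylog head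
Δ(𝔖_{(log₂ m)^E} ⊕ 1), E ≥ 2, HARD·KERNEL with NO uncomputed exponent (supersedes g35's E > D) · the
residual sliver log₂ m/log₂ log₂ m ≲ t ≲ log₂ m·log₂ log₂ m (contains t = log₂ m) stays
UNDECIDED · IDEA-NEEDED · P-ROW and cyclic notches untouched · 0 S-currency · closes NO item ·
VP ≠ VNP untouched»

— in this file the content is that the `EqHard` conclusions hold UNCONDITIONALLY in the
Landsberg–Ressayre model.  [cite: DawarWilsenach2025, Thm. 7.1] [cite: LandsbergRessayre2017,
Question 2.2]  Reused BY NAME: `nearExp_of_heredity`, `pow_add_le_two_pow_log`,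
`polylog_eventually_lt`, `diagReach_head`, `headPerms`, `diagHom`.
-/

set_option linter.dupNamespace false

noncomputable section

namespace Summit.ValiantsHypothesis.ValiantsHypothesis.Theorems.EquivariantDialThresholdPermify

open MvPolynomial Matrix Literature.Computability.AlgebraicComplexity
open Summit.ValiantsHypothesis.ValiantsHypothesis.Theses
open Summit.ValiantsHypothesis.ValiantsHypothesis.Theorems.EquivariantDialNode
open Summit.ValiantsHypothesis.ValiantsHypothesis.Theorems.EquivariantDialPolyIndex
open Summit.ValiantsHypothesis.ValiantsHypothesis.Theorems.EquivariantDialDiagonalPermify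
open Summit.ValiantsHypothesis.ValiantsHypothesis.Theorems.EquivariantDialRateHeredity
open Summit.ValiantsHypothesis.ValiantsHypothesis.Theorems.SymPencilEquivariantSdcNotQP.Closer

/-- ★★ **`EqHard` FROM NEAR-EXPONENTIAL RATE HEREDITY.**  If `K` has diagonal reach `b` with
`(log₂ (n + b n) + 1)(log₂ n + 1) = o(n)`, then `per_m` has no polynomial `K`-equivariant family:
a family of sizes `≤ m^c + c ≤ 2^{c (log₂ m + 1) + c + 1}` would give
`n ≤ a (2c + 2)(log₂ (n + b n) + 1)(log₂ n + 1)` infinitely often (`nearExp_of_heredity`).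
[folklore; cite: LandsbergRessayre2017, Question 2.2] -/
theorem eqHard_of_nearExpHeredity
    (K : ∀ m : ℕ, Subgroup (Equiv.Perm (Fin m) × Equiv.Perm (Fin m))) (b : ℕ → ℕ)
    (hK : ∀ n, ((⊤ : Subgroup (Equiv.Perm (Fin n))).map (diagHom n)).map
      ((headExt n (b n)).prodMap (headExt n (b n))) ≤ K (n + b n))
    (ho : ∀ a : ℕ, ∃ n₀ : ℕ, ∀ n ≥ n₀, a * (Nat.log 2 (n + b n) + 1) * (Nat.log 2 n + 1) < n) :
    EqHard fun m => (K m).map (biPermHom m) := by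
  intro hP
  obtain ⟨c, hc⟩ := hP
  obtain ⟨a, ha⟩ := nearExp_of_heredity K b (fun m => c * (Nat.log 2 m + 1) + c + 1) hK fun m => by
    obtain ⟨s, hs, hA⟩ := hc m
    exact ⟨s, hs.trans (pow_add_le_two_pow_log m c), hA⟩
  obtain ⟨n₀, hn₀⟩ := ho (a * (2 * c + 2))
  obtain ⟨n, hn, hle⟩ := ha n₀
  have hlt := hn₀ n hn
  have h1 : c * (Nat.log 2 (n + b n) + 1) + c + 1 + 1 ≤ (2 * c + 2) * (Nat.log 2 (n + b n) + 1) := by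
    nlinarith [Nat.zero_le (c * Nat.log 2 (n + b n)), Nat.zero_le (Nat.log 2 (n + b n))]
  have hmid : a * (c * (Nat.log 2 (n + b n) + 1) + c + 1 + 1) * (Nat.log 2 n + 1) ≤
      a * (2 * c + 2) * (Nat.log 2 (n + b n) + 1) * (Nat.log 2 n + 1) :=
    calc a * (c * (Nat.log 2 (n + b n) + 1) + c + 1 + 1) * (Nat.log 2 n + 1)
        ≤ a * ((2 * c + 2) * (Nat.log 2 (n + b n) + 1)) * (Nat.log 2 n + 1) :=
          Nat.mul_le_mul_right _ (Nat.mul_le_mul_left _ h1)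
      _ = a * (2 * c + 2) * (Nat.log 2 (n + b n) + 1) * (Nat.log 2 n + 1) := by ring
  exact absurd (hle.trans hmid) (not_le.mpr hlt)

/-- Growth lemma: `a (2⌊√n⌋ + 3)(log₂ n + 1) < n` eventually — squares: `(2⌊√n⌋ + 3)^2 ≤ 25 n` and
`(25 a^2 + 1)(log₂ n + 1)^2 < n` eventually (`polylog_eventually_lt`). [folklore] -/
theorem sqrt_log_eventually_lt (a : ℕ) :
    ∃ n₀ : ℕ, ∀ n ≥ n₀, a * (2 * (Nat.sqrt n + 1) + 1) * (Nat.log 2 n + 1) < n := by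
  have hD : (0 : ℝ) < 25 * (a : ℝ) ^ 2 + 1 := by positivity
  obtain ⟨N, hN⟩ :=
    polylog_eventually_lt 2 1 (show (0 : ℝ) < 1 / (25 * (a : ℝ) ^ 2 + 1) by positivity)
  refine ⟨max N 1, fun n hn => ?_⟩
  have hnN : N ≤ n := le_of_max_le_left hn
  have hn1 : 1 ≤ n := le_of_max_le_right hn
  have h := hN n hnN
  rw [one_div, inv_mul_eq_div, lt_div_iff₀ hD] at h
  have hlog : (Nat.log 2 n + 1) ^ 2 * (25 * a ^ 2 + 1) < n := by exact_mod_cast h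
  have hqq : Nat.sqrt n * Nat.sqrt n ≤ n := Nat.sqrt_le n
  have hqn : Nat.sqrt n ≤ n := Nat.sqrt_le_self n
  have hsq : (2 * (Nat.sqrt n + 1) + 1) * (2 * (Nat.sqrt n + 1) + 1) ≤ 25 * n := by nlinarith
  have hPP : (a * (2 * (Nat.sqrt n + 1) + 1) * (Nat.log 2 n + 1)) *
      (a * (2 * (Nat.sqrt n + 1) + 1) * (Nat.log 2 n + 1)) < n * n :=
    calc (a * (2 * (Nat.sqrt n + 1) + 1) * (Nat.log 2 n + 1)) *
          (a * (2 * (Nat.sqrt n + 1) + 1) * (Nat.log 2 n + 1))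
        = a * a * ((2 * (Nat.sqrt n + 1) + 1) * (2 * (Nat.sqrt n + 1) + 1)) *
            ((Nat.log 2 n + 1) * (Nat.log 2 n + 1)) := by ring
      _ ≤ a * a * (25 * n) * ((Nat.log 2 n + 1) * (Nat.log 2 n + 1)) :=
          Nat.mul_le_mul_right _ (Nat.mul_le_mul_left _ hsq)
      _ = n * ((Nat.log 2 n + 1) ^ 2 * (25 * a ^ 2)) := by ring
      _ ≤ n * ((Nat.log 2 n + 1) ^ 2 * (25 * a ^ 2 + 1)) :=
          Nat.mul_le_mul_left _ (Nat.mul_le_mul_left _ (Nat.le_succ _))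
      _ < n * n := mul_lt_mul_of_pos_left hlog (by omega)
  by_contra hc
  exact absurd (Nat.mul_le_mul (not_lt.mp hc) (not_lt.mp hc)) (not_le.mpr hPP)

/-- ★★ **ALL POLYLOG HEADS ARE HARD.**  For every `E ≥ 2` the permanents have no polynomial family
of `Δ(𝔖_{(log₂ m)^E} ⊕ 1)`-equivariant (exact `GL × GL` lifts) affine determinantal representations.
Reach `m(n) = 2^{2(⌊√n⌋ + 1)}` (so `n ≤ (log₂ m(n))^2 ≤ (log₂ m(n))^E`), `eqHard_of_nearExpHeredity`
with `sqrt_log_eventually_lt`.  Previously known only for `E > D` (`eqHard_diagHead_polylog`, g35).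
S-implied conclusion, proved unconditionally; 0 S-currency; closes NO item.
[cite: DawarWilsenach2025, Thm. 7.1] [cite: LandsbergRessayre2017, Question 2.2] -/
theorem eqHard_diagHead_polylog_two (E : ℕ) (hE : 2 ≤ E) :
    EqHard (diagHeadSubst fun m => Nat.log 2 m ^ E) := by
  have hpow : ∀ n : ℕ, n ≤ 2 ^ (2 * (Nat.sqrt n + 1)) := fun n =>
    calc n ≤ (Nat.sqrt n + 1) ^ 2 := (Nat.lt_succ_sqrt' n).le
      _ ≤ (2 ^ (Nat.sqrt n + 1)) ^ 2 := Nat.pow_le_pow_left Nat.lt_two_pow_self.le 2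
      _ = 2 ^ (2 * (Nat.sqrt n + 1)) := by rw [← pow_mul, Nat.mul_comm]
  have hm : ∀ n : ℕ, n + (2 ^ (2 * (Nat.sqrt n + 1)) - n) = 2 ^ (2 * (Nat.sqrt n + 1)) := fun n =>
    Nat.add_sub_cancel' (hpow n)
  refine eqHard_of_nearExpHeredity (fun m => (headPerms m (Nat.log 2 m ^ E)).map (diagHom m))
    (fun n => 2 ^ (2 * (Nat.sqrt n + 1)) - n)
    (diagReach_head (t := fun m => Nat.log 2 m ^ E) _ fun n => ?_) fun a => ?_
  · show n ≤ Nat.log 2 (n + (2 ^ (2 * (Nat.sqrt n + 1)) - n)) ^ E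
    rw [hm n, Nat.log_pow Nat.one_lt_two]
    calc n ≤ (Nat.sqrt n + 1) ^ 2 := (Nat.lt_succ_sqrt' n).le
      _ ≤ (2 * (Nat.sqrt n + 1)) ^ 2 := Nat.pow_le_pow_left (by omega) 2
      _ ≤ (2 * (Nat.sqrt n + 1)) ^ E := Nat.pow_le_pow_right (by omega) hE
  · obtain ⟨n₀, hn₀⟩ := sqrt_log_eventually_lt a
    refine ⟨n₀, fun n hn => ?_⟩
    show a * (Nat.log 2 (n + (2 ^ (2 * (Nat.sqrt n + 1)) - n)) + 1) * (Nat.log 2 n + 1) < n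
    rw [hm n, Nat.log_pow Nat.one_lt_two]
    exact hn₀ n hn

end Summit.ValiantsHypothesis.ValiantsHypothesis.Theorems.EquivariantDialThresholdPermify

end
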